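import Mathlib.Data.Nat.Sqrt
import Literature.Computability.Complexity.AdditiveRealClasses
import Literature.Computability.Complexity.AdaptiveQueries
import Literature.Computability.Complexity.BrickAlgebra
import HarnessLib

/-!
# Mean-payoff games over the additive reals: the digital certificate verifier (definitions)

Topic `Literature/Computability/Complexity`, grouping namespace `MPGSignVerifier`. The real
mean-payoff language `MPGReal` (`MeanPayoffGame.lean`: inputs `x ∈ ℝⁿ`, `n = k + 2k²`, read as `k`
owner bits, `k²` edge indicators and `k²` weights; yes iff the arena is total and vertex `0` carries
a potential certificate `(σ, R, π)`) belongs to Koiran's digital nondeterministic class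
`NDP⁰_ℝovs` (`AdditiveRealClasses.NDPAdd`): a Boolean witness names `σ` and `R` and — this is the
point of the present rendering — ALSO a potential, which can be taken to be a sum of at most `k - 1`
weights with multiplicity (shortest-walk potentials, `Literature/Combinatorics/Optimization/
FeasiblePotentialWalks.lean`, the difference-constraints form of Bellman–Ford [CLRS2009, Thm 24.9]);
every condition of the certificate is then the sign of an INTEGER affine form in `x`, i.e. one query
to the sign oracle of `x` [FournierKoiran2000, §2 Remark 1 and §3 (the class `NDP⁰`, Fact 2)].
No Bellman–Ford run is needed inside the machine: the verifier is NON-ADAPTIVE given the witness.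

This file only DEFINES the verifier; `MPGSignVerifierFP.lean` proves that its query generator is in
`FP` and its verdict in `P` (so the machine is polynomial-time, `AdQuery.isPolyTime_adAlg`), and
`MPGRealNDPAdd.lean` proves soundness and completeness (`MPGReal ∈ NDPAdd`).

* Witness layout (`Env = (n, y)`, `k = arena n = ⌊√(n/2)⌋`, bit string `y` read positionally with
  default `false`, numbers in `k`-bit fields, least significant bit first): flags `inR u` (bit `u`),
  `isMax u` (bit `k + u`, the CLAIM "owner bit of `u` is `1`"), `side u` (bit `2k + u`, for a Min
  claim: which strict side of `1`), `noEdge u u'` (bit `3k + uk + u'`, the claim "no edge `u → u'`")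
  and `noEdgeSide u u'` (bit `3k + k² + uk + u'`); numeric fields `num j` at `3k + 2k² + jk`:
  `tot u = num u ⊓ (k-1)` (an out-neighbour of `u`, totality), `succ u = num (k + u) ⊓ (k-1)`
  (`σ u`), `coef v i = num (2k + vn + i)` (the multiplicity of coordinate `i` in `π v`, so
  `π v = Σᵢ coef v i · xᵢ`).
* Queries (`List ℤ` = `[c, a₀, …, a_{n-1}]`, value `c + Σ aᵢxᵢ`, answered `[0 ≤ value]`):
  `unitQ n m c s` (`c + s·x_m`), hence `geOne`/`leOne` (`x_m ≥ 1`, `x_m ≤ 1`), and `potQ u v`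
  (`π u - π v + w(u,v) ≥ 0`, the potential inequality of the edge `u → v`).
* `checks e : List (List ℤ × Bool)` — four slots per vertex and three per ordered pair, each a query
  with its EXPECTED answer (strict tests `x_m < 1` are "query `x_m ≥ 1`, expect `false`"); unused
  slots hold the trivial query `[]` (value `0`, answer `true`); `queryAt`, `expected`.
* `sideOK` (the Boolean part: `0 ∈ R`, closure of `R`), `valid` (`n = k + 2k²`, `k ≥ 1`),
  `accepts e bits` (valid, side conditions, and the first answers are the expected ones).
* The machine: `qgen` (query generator on transcripts `⟨⟨1ⁿ, y⟩, answer bits⟩`: the query of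
  index = number of answers so far), `Verdict`, and `verifier = adAlg qgen X Verdict`
  (`AdaptiveQueries.lean`; it asks `|⟨1ⁿ, y⟩|` queries, at least the `4k + 3k²` needed).

## References

* H. Fournier, P. Koiran, *Lower bounds are not easier over the reals: inside PH*, ICALP 2000,
  LNCS 1853 = LIP RR-1999-21, §2 (Remark 1: tests are integer affine forms), §3 (`NDP⁰_ℝovs`,
  Fact 2). [FournierKoiran2000]
* U. Zwick, M. Paterson, *The complexity of mean payoff games on graphs*, COCOON 1995 / TCS 158
  (1996), Thm 7 (`MPG ∈ NP ∩ coNP` via positional strategies and potentials). [ZwickPaterson1995]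
* T. H. Cormen et al., *Introduction to Algorithms*, 3rd ed., 2009, §24.4 Thm 24.9. [CLRS2009]
-/

namespace Literature.Computability.Complexity

namespace MPGSignVerifier

open _root_.Computability Brick

/-! ### Arena size and witness layout -/

/-- An environment: the dimension `n` and the witness bit string `y` (the two fields of the
verifier's Boolean input `⟨1ⁿ, y⟩`). [folklore] -/
abbrev Env : Type := ℕ × List Bool

/-- The arena size read off the dimension: for `n = k + 2k²`, `⌊√(n/2)⌋ = k` (`arena_eq`).
[folklore] -/
def arena (n : ℕ) : ℕ := Nat.sqrt (n / 2)

/-- The dimension is well formed: `k = arena n ≥ 1` and `n = k + 2k²`. [folklore] -/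
def valid (n : ℕ) : Bool :=
  decide (0 < arena n) && decide (arena n + 2 * arena n * arena n = n)

/-- The arena size of an environment. [folklore] -/
def kOf (e : Env) : ℕ := arena e.1

/-- Bit `p` of the witness (`false` past its end). [folklore] -/
def rd (e : Env) (p : ℕ) : Bool := e.2.getD p false

/-- The `k`-bit numeric field of the witness starting at position `p` (least significant bit first;
missing bits read `false`). [folklore] -/
def fld (e : Env) (p : ℕ) : ℕ := bitsToNat ((e.2.drop p).take (kOf e))

/-- Flag: `u ∈ R`. [folklore] -/
def inR (e : Env) (u : ℕ) : Bool := rd e u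

/-- Claim: the owner bit of `u` equals `1` (Max moves at `u`). [folklore] -/
def isMax (e : Env) (u : ℕ) : Bool := rd e (kOf e + u)

/-- For a Min claim at `u`: `true` claims `x_u < 1`, `false` claims `x_u > 1`. [folklore] -/
def side (e : Env) (u : ℕ) : Bool := rd e (2 * kOf e + u)

/-- Claim: there is no edge `u → u'` (its indicator is `≠ 1`). [folklore] -/
def noEdge (e : Env) (u u' : ℕ) : Bool := rd e (3 * kOf e + (u * kOf e + u'))

/-- For a no-edge claim: `true` claims indicator `< 1`, `false` claims `> 1`. [folklore] -/
def noEdgeSide (e : Env) (u u' : ℕ) : Bool := rd e (3 * kOf e + kOf e * kOf e + (u * kOf e + u'))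

/-- Start of the numeric fields. [folklore] -/
def numBase (k : ℕ) : ℕ := 3 * k + 2 * k * k

/-- The `j`-th numeric field. [folklore] -/
def num (e : Env) (j : ℕ) : ℕ := fld e (numBase (kOf e) + j * kOf e)

/-- The designated out-neighbour of `u` (totality witness), capped to a vertex. [folklore] -/
def tot (e : Env) (u : ℕ) : ℕ := min (kOf e - 1) (num e u)

/-- Max's positional choice `σ u`, capped to a vertex. [folklore] -/
def succ (e : Env) (u : ℕ) : ℕ := min (kOf e - 1) (num e (kOf e + u))

/-- The multiplicity of the coordinate `i < n` in the potential of `v`: `π v = Σᵢ coef v i · xᵢ`.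
[folklore] -/
def coef (e : Env) (v i : ℕ) : ℕ := num e (2 * kOf e + (v * e.1 + i))

/-- Coordinate of the indicator of the edge `u → u'`. [folklore] -/
def edgeIdx (k u u' : ℕ) : ℕ := k + (u * k + u')

/-- Coordinate of the weight of the edge `u → u'`. [folklore] -/
def wIdx (k u u' : ℕ) : ℕ := k + k * k + (u * k + u')

/-! ### Queries -/

/-- The query `c + s · x_m` (as the integer list `[c, 0, …, s, …, 0]` of length `n + 1`).
[cite: FournierKoiran2000, §2 Remark 1] -/
def unitQ (n m : ℕ) (c s : ℤ) : List ℤ :=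
  c :: (List.range n).map fun i => if i = m then s else 0

/-- The query `x_m - 1` (answer `true` iff `1 ≤ x_m`). [folklore] -/
def geOne (n m : ℕ) : List ℤ := unitQ n m (-1) 1

/-- The query `1 - x_m` (answer `true` iff `x_m ≤ 1`). [folklore] -/
def leOne (n m : ℕ) : List ℤ := unitQ n m 1 (-1)

/-- The potential query of the edge `u → v`: `π u - π v + w(u,v)` with `π v = Σᵢ coef v i · xᵢ`
(answer `true` iff `π v ≤ π u + w(u,v)`). [cite: CLRS2009, §24.4 (difference constraints)] -/
def potQ (e : Env) (u v : ℕ) : List ℤ :=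
  0 :: (List.range e.1).map fun i =>
    ((coef e u i : ℤ) - (coef e v i : ℤ)) + (if i = wIdx (kOf e) u v then 1 else 0)

/-- The trivial slot: the empty query (value `0`, answer `true`), expected `true`. [folklore] -/
def triv : List ℤ × Bool := ([], true)

/-! ### The checks -/

/-- Slot 1 of vertex `u`: the owner claim — `x_u ≥ 1` expected `true` (Max), or the claimed strict
side of `1` expected `false` (Min). [folklore] -/
def slot1 (e : Env) (u : ℕ) : List ℤ × Bool :=
  if isMax e u then (geOne e.1 u, true)
  else if side e u then (geOne e.1 u, false) else (leOne e.1 u, false)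

/-- Slot 2 of vertex `u`: `x_u ≤ 1` expected `true` for a Max claim. [folklore] -/
def slot2 (e : Env) (u : ℕ) : List ℤ × Bool :=
  if isMax e u then (leOne e.1 u, true) else triv

/-- Slot 3 of vertex `u`: the indicator of `u → tot u` is `≥ 1`. [folklore] -/
def slot3 (e : Env) (u : ℕ) : List ℤ × Bool := (geOne e.1 (edgeIdx (kOf e) u (tot e u)), true)

/-- Slot 4 of vertex `u`: the indicator of `u → tot u` is `≤ 1`. [folklore] -/
def slot4 (e : Env) (u : ℕ) : List ℤ × Bool := (leOne e.1 (edgeIdx (kOf e) u (tot e u)), true)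

/-- Slot 5 of the pair `(u, u')`, for `u ∈ R`: Max — the indicator of `u → σ u` is `≥ 1` (at
`u' = σ u`); Min — the claimed strict side of a no-edge claim, expected `false`. [folklore] -/
def slot5 (e : Env) (u u' : ℕ) : List ℤ × Bool :=
  if inR e u then
    if isMax e u then (if u' = succ e u then (geOne e.1 (edgeIdx (kOf e) u u'), true) else triv)
    else if noEdge e u u' then
      (if noEdgeSide e u u' then (geOne e.1 (edgeIdx (kOf e) u u'), false)
        else (leOne e.1 (edgeIdx (kOf e) u u'), false))
    else triv
  else triv

/-- Slot 6 of the pair `(u, u')`, for `u ∈ R`: Max — the indicator of `u → σ u` is `≤ 1`; Min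
without a no-edge claim — the potential inequality of `u → u'`. [folklore] -/
def slot6 (e : Env) (u u' : ℕ) : List ℤ × Bool :=
  if inR e u then
    if isMax e u then (if u' = succ e u then (leOne e.1 (edgeIdx (kOf e) u u'), true) else triv)
    else if noEdge e u u' then triv else (potQ e u u', true)
  else triv

/-- Slot 7 of the pair `(u, u')`: for a Max vertex `u ∈ R` and `u' = σ u`, the potential inequality
of `u → σ u`. [folklore] -/
def slot7 (e : Env) (u u' : ℕ) : List ℤ × Bool :=
  if inR e u && isMax e u && decide (u' = succ e u) then (potQ e u u', true) else triv

/-- The four slots of a vertex. [folklore] -/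
def vertexSlots (e : Env) (u : ℕ) : List (List ℤ × Bool) := [slot1 e u, slot2 e u, slot3 e u, slot4 e u]

/-- The three slots of an ordered pair. [folklore] -/
def pairSlots (e : Env) (u u' : ℕ) : List (List ℤ × Bool) := [slot5 e u u', slot6 e u u', slot7 e u u']

/-- All slots of the pairs `(u, ·)`. [folklore] -/
def rowSlots (e : Env) (u : ℕ) : List (List ℤ × Bool) :=
  ((List.range (kOf e)).map (pairSlots e u)).flatten

/-- **The list of checks** (query, expected answer): `4k` vertex slots then `3k²` pair slots.
[folklore] -/
def checks (e : Env) : List (List ℤ × Bool) :=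
  ((List.range (kOf e)).map (vertexSlots e)).flatten ++ ((List.range (kOf e)).map (rowSlots e)).flatten

/-- The `i`-th query (the trivial query past the end of the checks). [folklore] -/
def queryAt (e : Env) (i : ℕ) : List ℤ := ((checks e).map Prod.fst).getD i []

/-- The expected answers. [folklore] -/
def expected (e : Env) : List Bool := (checks e).map Prod.snd

/-! ### The verdict -/

/-- The Boolean side conditions of the certificate: `0 ∈ R`; for `u ∈ R` claimed Max, `σ u ∈ R`;
for `u ∈ R` claimed Min, every `u'` without a no-edge claim is in `R`. [folklore] -/
def sideOK (e : Env) : Bool :=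
  inR e 0 && (List.range (kOf e)).all fun u =>
    !inR e u || (if isMax e u then inR e (succ e u) else (List.range (kOf e)).all fun u' => noEdge e u u' || inR e u')

/-- **Acceptance**: the dimension is well formed, the side conditions hold, and the answers received
begin with the expected ones. [folklore] -/
def accepts (e : Env) (bits : List Bool) : Bool :=
  valid e.1 && sideOK e && decide (bits.take (expected e).length = expected e)

/-! ### The machine -/

/-- The dimension read off a transcript `⟨⟨1ⁿ, y⟩, bits⟩` (length of the first field of the first
field; total on all strings). [folklore] -/
def nOf (w : List Bool) : ℕ := (fstF (fstF w)).length

/-- The witness read off a transcript. [folklore] -/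
def yOf (w : List Bool) : List Bool := sndF (fstF w)

/-- The answer bits read off a transcript. [folklore] -/
def bitsOf (w : List Bool) : List Bool := sndF w

/-- The environment of a transcript. [folklore] -/
def envOf (w : List Bool) : Env := (nOf w, yOf w)

/-- **The query generator**: on `⟨⟨1ⁿ, y⟩, bits⟩`, the code (`encodingIntBool.listBool`) of the query
of index `|bits|` = the number of answers received so far. [cite: FournierKoiran2000, §3 (NDP⁰: the verifier)] -/
def qgen (w : List Bool) : List Bool :=
  (encodingIntBool.listBool).encode (queryAt (envOf w) (bitsOf w).length)

/-- **The verdict language**: transcripts that are accepted. [folklore] -/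
def Verdict : Language Bool := {w | accepts (envOf w) (bitsOf w) = true}

/-- **The verifier**: the oracle algorithm asking `qgen` on the answers so far, `|⟨1ⁿ, y⟩|` times,
then deciding by `Verdict` (`AdQuery.adAlg`). [cite: FournierKoiran2000, §3 (NDP⁰_ℝovs)] -/
noncomputable def verifier : OracleAlg Bool := AdQuery.adAlg qgen Polynomial.X Verdict

/-! ### Unfolding on genuine transcripts -/

/-- Length of a unary numeral (private copy of a lemma several machine files keep privately).
[folklore] -/
private theorem length_unaryEncodeNat' (k : ℕ) : (unaryEncodeNat k).length = k := by
  induction k with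
  | zero => rfl
  | succ k ih => rw [unaryEncodeNat, List.length_cons, ih]

/-- The environment of a genuine transcript. [folklore] -/
@[simp] theorem envOf_boolPair (n : ℕ) (y bits : List Bool) :
    envOf (boolPair (boolPair (unaryEncodeNat n) y) bits) = (n, y) := by
  simp only [envOf, nOf, yOf, fstF_boolPair, sndF_boolPair, length_unaryEncodeNat']

/-- The answer bits of a genuine transcript. [folklore] -/
@[simp] theorem bitsOf_boolPair (x bits : List Bool) : bitsOf (boolPair x bits) = bits :=
  sndF_boolPair _ _

/-- The arena size of a well-formed dimension. [folklore] -/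
theorem arena_eq {k : ℕ} : arena (k + 2 * k * k) = k := by
  unfold arena
  have h : (k + 2 * k * k) / 2 = k * k + k / 2 := by
    rw [show k + 2 * k * k = k + 2 * (k * k) by ring, Nat.add_mul_div_left _ _ (by norm_num), add_comm]
  rw [h]
  exact Nat.sqrt_add_eq k (by omega)

/-- `valid` recognises exactly the well-formed dimensions. [folklore] -/
theorem valid_eq_true_iff (n : ℕ) : valid n = true ↔ ∃ k, 0 < k ∧ n = k + 2 * k * k := by
  simp only [valid, Bool.and_eq_true, decide_eq_true_eq]
  constructor
  · rintro ⟨h0, hn⟩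
    exact ⟨arena n, h0, hn.symm⟩
  · rintro ⟨k, hk, rfl⟩
    rw [arena_eq]
    exact ⟨hk, rfl⟩

/-- The arena size is at most the dimension. [folklore] -/
theorem arena_le (n : ℕ) : arena n ≤ n :=
  (Nat.sqrt_le_self _).trans (Nat.div_le_self n 2)

/-- Number of checks: `4k + 3k²`. [folklore] -/
theorem length_checks (e : Env) : (checks e).length = 4 * kOf e + 3 * kOf e * kOf e := by
  simp [checks, List.length_flatten, vertexSlots, rowSlots, pairSlots, Function.comp_def]
  ring

end MPGSignVerifier

end Literature.Computability.Complexity
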